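import Summits.CriticalPhenomena.PercolationContinuityZ3.Theorems.PercNearOneGluingNoHeavyLowerTailDualBHKEvents
import HarnessLib

/-!
# Dual BHK inequality — cluster algebra for the base cases

Support file 5/7 for the dual BHK inequality `u_b·u_c ≥ t·n′_a` (memo `prim-ineq-gen-2/DUAL-BHK.md` §8, Lemma E and the
base-type steps (3) of Theorems 1 and 2; `--supports stmt-CriticalPhenomena-4575`).  Pointwise identities between the
events at a fixed configuration (`hM`, `hX` = the plain cluster meets `M`, `X`):
* `t(M,X) = α ∪ β` with `α = e₄(M;X)` ("`hM` and the `M`-glued class meets `X`"), `β = e₄(X;M)`, and `α ∩ β = hM ∧ hX`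
  (`mem_evT_iff_evE4_or`, `mem_evE4_and_evE4_iff`);  with `u ∈ M ∩ X`: `t(M,X) = hM ∨ hX`;
* `h(M) = Ξ(M;∅)` splits as `Ξ(M;X) ⊔ α`;  `e₂(M;∅,X)` (`hM ∧ Sep(M,X)`) splits as `e₂(M;X,X) ⊔ (hM ∧ hX ∧ Sep)`;
  `Sep(M,X)` splits by `hM, hX` into `q⁺(M∪X;M,X) ⊔ e₂(M;X,X) ⊔ e₂(X;M,M) ⊔ (hM ∧ hX ∧ Sep)`;
* symmetry `t(M,X) = t(X,M)`.  [this work]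
-/

namespace Summit.CriticalPhenomena.PercolationContinuityZ3.Theorems

namespace DualBHK

open SimpleGraph

variable {V : Type*} [DecidableEq V] {U : Finset V} {E F : Finset (Sym2 V)} {a : V} {S : Finset (Sym2 V)}

/-- `t` is symmetric: `evT M X = evT X M`. [this work] -/
theorem evT_comm (M X : Set V) : evT U F a M X = evT U F a X M := by
  ext S
  simp only [mem_evT, sG_comm U (S ∪ F) M X]
  exact and_comm

/-- `h(A) = Ξ(A;∅)` is the plain hitting event: the `A`-glued class meets `A` iff the plain cluster does. [this work] -/
theorem mem_evXi_empty_iff (A : Set V) :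
    S ∈ evXi U F a A ∅ ↔ ∃ m ∈ A, (sG U (S ∪ F) ∅ ∅).Reachable a m := by
  simp only [mem_evXi, Set.mem_empty_iff_false, false_implies, implies_true, and_true]
  exact hits_hub_iff_hits_plain A ∅

/-- `α = e₄(M;X)` unfolded: `hM` (plain) and the `M`-glued class of `a` meets `X`. [this work] -/
theorem mem_evE4_iff_plain (M X : Set V) :
    S ∈ evE4 U F a M X ↔ (∃ m ∈ M, (sG U (S ∪ F) ∅ ∅).Reachable a m) ∧
      ∃ x ∈ X, (sG U (S ∪ F) M ∅).Reachable a x := by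
  simp only [mem_evE4, hits_hub_iff_hits_plain M ∅]

/-- If the plain cluster meets `M` and `X` then `α` holds (the glued class contains the plain cluster). [this work] -/
theorem mem_evE4_of_hits {M X : Set V} (hM : ∃ m ∈ M, (sG U (S ∪ F) ∅ ∅).Reachable a m)
    (hX : ∃ x ∈ X, (sG U (S ∪ F) ∅ ∅).Reachable a x) : S ∈ evE4 U F a M X := by
  rw [mem_evE4_iff_plain]
  refine ⟨hM, ?_⟩
  obtain ⟨x, hx, h⟩ := hX
  exact ⟨x, hx, h.mono (sG_mono_left U (S ∪ F) (Set.empty_subset M) ∅)⟩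

/-- **`α ∩ β = hM ∧ hX`.** [this work] -/
theorem mem_evE4_and_evE4_iff (M X : Set V) :
    (S ∈ evE4 U F a M X ∧ S ∈ evE4 U F a X M) ↔
      (∃ m ∈ M, (sG U (S ∪ F) ∅ ∅).Reachable a m) ∧ ∃ x ∈ X, (sG U (S ∪ F) ∅ ∅).Reachable a x := by
  constructor
  · rintro ⟨h1, h2⟩
    exact ⟨((mem_evE4_iff_plain M X).1 h1).1, ((mem_evE4_iff_plain X M).1 h2).1⟩
  · rintro ⟨hM, hX⟩
    exact ⟨mem_evE4_of_hits hM hX, mem_evE4_of_hits hX hM⟩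

/-- **`t(M,X) = α ∪ β`** (memo Lemma E(ii)): the `(M,X)`-glued class meets both `M` and `X` iff (`hM` and the `M`-glued
class meets `X`) or (`hX` and the `X`-glued class meets `M`). [this work] -/
theorem mem_evT_iff_evE4_or (M X : Set V) : S ∈ evT U F a M X ↔ S ∈ evE4 U F a M X ∨ S ∈ evE4 U F a X M := by
  constructor
  · rintro ⟨hM, hX⟩
    -- the glued class meets `M` iff the `X`-glued class meets `M` plain-wise … organise by whether `hM` holds
    by_cases hMp : ∃ m ∈ M, (sG U (S ∪ F) ∅ ∅).Reachable a m
    · left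
      rw [mem_evE4_iff_plain]
      refine ⟨hMp, ?_⟩
      by_contra hno
      push Not at hno
      -- the second hub `X` is unused
      obtain ⟨x, hx, h⟩ := hX
      exact hno x hx ((reach_two_hubs_iff_of_miss hno x).1 h)
    · right
      by_cases hXp : ∃ x ∈ X, (sG U (S ∪ F) ∅ ∅).Reachable a x
      · rw [mem_evE4_iff_plain]
        refine ⟨hXp, ?_⟩
        by_contra hno
        push Not at hno
        obtain ⟨m, hm, h⟩ := hM
        rw [sG_comm] at h
        exact hno m hm ((reach_two_hubs_iff_of_miss hno m).1 h)
      · -- neither hub is ever entered: the class is the plain cluster, contradiction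
        exfalso
        push Not at hMp hXp
        have h1 : ∀ y, (sG U (S ∪ F) M ∅).Reachable a y ↔ (sG U (S ∪ F) ∅ ∅).Reachable a y :=
          reach_hub_iff_of_miss hMp
        have hXM : ∀ x ∈ X, ¬ (sG U (S ∪ F) M ∅).Reachable a x := fun x hx h => hXp x hx ((h1 x).1 h)
        obtain ⟨m, hm, h⟩ := hM
        exact hMp m hm ((h1 m).1 ((reach_two_hubs_iff_of_miss hXM m).1 h))
  · rintro (h | h)
    · obtain ⟨hMp, x, hx, hr⟩ := (mem_evE4_iff_plain M X).1 h
      obtain ⟨m, hm, hrm⟩ := hMp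
      exact ⟨⟨m, hm, hrm.mono ((sG_mono_left U (S ∪ F) (Set.empty_subset M) ∅).trans
        (sG_mono_right U (S ∪ F) M (Set.empty_subset X)))⟩,
        ⟨x, hx, hr.mono (sG_mono_right U (S ∪ F) M (Set.empty_subset X))⟩⟩
    · obtain ⟨hXp, m, hm, hr⟩ := (mem_evE4_iff_plain X M).1 h
      obtain ⟨x, hx, hrx⟩ := hXp
      rw [mem_evT, sG_comm]
      exact ⟨⟨m, hm, hr.mono (sG_mono_right U (S ∪ F) X (Set.empty_subset M))⟩,
        ⟨x, hx, hrx.mono ((sG_mono_left U (S ∪ F) (Set.empty_subset X) ∅).trans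
          (sG_mono_right U (S ∪ F) X (Set.empty_subset M)))⟩⟩

/-- With a common vertex `u ∈ M ∩ X` the two hubs are one class: `t(M,X) = hM ∨ hX`. [this work] -/
theorem mem_evT_iff_of_mem_inter {M X : Set V} {u : V} (huM : u ∈ M) (huX : u ∈ X) :
    S ∈ evT U F a M X ↔ (∃ m ∈ M, (sG U (S ∪ F) ∅ ∅).Reachable a m) ∨
      ∃ x ∈ X, (sG U (S ∪ F) ∅ ∅).Reachable a x := by
  rw [mem_evT_iff_evE4_or]
  constructor
  · rintro (h | h)
    · exact Or.inl ((mem_evE4_iff_plain M X).1 h).1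
    · exact Or.inr ((mem_evE4_iff_plain X M).1 h).1
  · rintro (⟨m, hm, h⟩ | ⟨x, hx, h⟩)
    · left
      rw [mem_evE4_iff_plain]
      refine ⟨⟨m, hm, h⟩, u, huX, ?_⟩
      -- `a ~ m`, and `m, u ∈ M` are glued
      have hm' : (sG U (S ∪ F) M ∅).Reachable a m := h.mono (sG_mono_left U (S ∪ F) (Set.empty_subset M) ∅)
      by_cases hmu : m = u
      · exact hmu ▸ hm'
      · exact hm'.trans (Adj.reachable (sG_adj.2 (Or.inr (Or.inl ⟨hmu, hm, huM⟩))))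
    · right
      rw [mem_evE4_iff_plain]
      refine ⟨⟨x, hx, h⟩, u, huM, ?_⟩
      have hx' : (sG U (S ∪ F) X ∅).Reachable a x := h.mono (sG_mono_left U (S ∪ F) (Set.empty_subset X) ∅)
      by_cases hxu : x = u
      · exact hxu ▸ hx'
      · exact hx'.trans (Adj.reachable (sG_adj.2 (Or.inr (Or.inl ⟨hxu, hx, huX⟩))))

/-- **`h(M) = Ξ(M;X) ⊔ α`**: the `M`-glued class meets `M` and either misses or meets `X`. [this work] -/
theorem mem_evXi_empty_iff_or (M X : Set V) :
    S ∈ evXi U F a M ∅ ↔ S ∈ evXi U F a M X ∨ S ∈ evE4 U F a M X := by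
  simp only [mem_evXi, mem_evE4, Set.mem_empty_iff_false, false_implies, implies_true, and_true]
  constructor
  · intro hM
    by_cases hX : ∃ x ∈ X, (sG U (S ∪ F) M ∅).Reachable a x
    · exact Or.inr ⟨hM, hX⟩
    · push Not at hX
      exact Or.inl ⟨hM, hX⟩
  · rintro (⟨hM, _⟩ | ⟨hM, _⟩) <;> exact hM

/-- … and the two pieces are disjoint. [this work] -/
theorem not_mem_evXi_and_evE4 (M X : Set V) : ¬ (S ∈ evXi U F a M X ∧ S ∈ evE4 U F a M X) := by
  rintro ⟨⟨_, hZ⟩, ⟨_, x, hx, h⟩⟩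
  exact hZ x hx h

/-- The event `hM ∧ hX ∧ Sep(M,X)` (the summand `g₃` of the memo). [this work] -/
theorem mem_g3_iff (M X : Set V) :
    S ∈ {S : Finset (Sym2 V) | (∃ m ∈ M, (sG U (S ∪ F) ∅ ∅).Reachable a m) ∧
        (∃ x ∈ X, (sG U (S ∪ F) ∅ ∅).Reachable a x) ∧ S ∪ F ∈ sepEv U E a M X} ↔
      (∃ m ∈ M, (sG U (S ∪ F) ∅ ∅).Reachable a m) ∧ (∃ x ∈ X, (sG U (S ∪ F) ∅ ∅).Reachable a x) ∧
        S ∪ F ∈ sepEv U E a M X := Iff.rfl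

/-- **`e₂(M;∅,X) = e₂(M;X,X) ⊔ g₃`**: `hM ∧ Sep(M,X)` splits by whether the cluster meets `X`. [this work] -/
theorem mem_evE2_empty_iff_or (M X : Set V) :
    S ∈ evE2 U E F a M ∅ X ↔ S ∈ evE2 U E F a M X X ∨
      ((∃ m ∈ M, (sG U (S ∪ F) ∅ ∅).Reachable a m) ∧ (∃ x ∈ X, (sG U (S ∪ F) ∅ ∅).Reachable a x) ∧
        S ∪ F ∈ sepEv U E a M X) := by
  simp only [mem_evE2, Set.mem_empty_iff_false, false_implies, implies_true, true_and]
  constructor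
  · rintro ⟨hM, hsep⟩
    by_cases hX : ∃ x ∈ X, (sG U (S ∪ F) ∅ ∅).Reachable a x
    · exact Or.inr ⟨hM, hX, hsep⟩
    · push Not at hX
      exact Or.inl ⟨hM, hX, hsep⟩
  · rintro (⟨hM, _, hsep⟩ | ⟨hM, _, hsep⟩) <;> exact ⟨hM, hsep⟩

/-- … disjointly. [this work] -/
theorem not_mem_evE2_and_g3 (M X : Set V) :
    ¬ (S ∈ evE2 U E F a M X X ∧ ((∃ m ∈ M, (sG U (S ∪ F) ∅ ∅).Reachable a m) ∧
      (∃ x ∈ X, (sG U (S ∪ F) ∅ ∅).Reachable a x) ∧ S ∪ F ∈ sepEv U E a M X)) := by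
  rintro ⟨⟨_, hY, _⟩, _, ⟨x, hx, h⟩, _⟩
  exact hY x hx h

/-- **`Sep(M,X)` split by `hM`, `hX`** (memo Thm 2 step (3)): the separation event is the disjoint union of
`q⁺(M∪X;M,X)` (`¬hM ∧ ¬hX`), `e₂(M;X,X)` (`hM ∧ ¬hX`), `e₂(X;M,M)` (`¬hM ∧ hX`) and `g₃` (`hM ∧ hX`). [this work] -/
theorem mem_sep_split (M X : Set V) :
    S ∈ {S : Finset (Sym2 V) | S ∪ F ∈ sepEv U E a M X} ↔
      S ∈ evQp U E F a (M ∪ X) M X ∨ S ∈ evE2 U E F a M X X ∨ S ∈ evE2 U E F a X M M ∨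
      ((∃ m ∈ M, (sG U (S ∪ F) ∅ ∅).Reachable a m) ∧ (∃ x ∈ X, (sG U (S ∪ F) ∅ ∅).Reachable a x) ∧
        S ∪ F ∈ sepEv U E a M X) := by
  simp only [Set.mem_setOf_eq, mem_evQp, mem_evE2, Set.mem_union]
  rw [sepEv_comm X M]
  constructor
  · intro hsep
    by_cases hM : ∃ m ∈ M, (sG U (S ∪ F) ∅ ∅).Reachable a m <;>
      by_cases hX : ∃ x ∈ X, (sG U (S ∪ F) ∅ ∅).Reachable a x
    · exact Or.inr (Or.inr (Or.inr ⟨hM, hX, hsep⟩))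
    · push Not at hX
      exact Or.inr (Or.inl ⟨hM, hX, hsep⟩)
    · push Not at hM
      exact Or.inr (Or.inr (Or.inl ⟨hX, hM, hsep⟩))
    · push Not at hM hX
      refine Or.inl ⟨?_, hsep⟩
      rintro z (hz | hz)
      · exact hM z hz
      · exact hX z hz
  · rintro (⟨_, h⟩ | ⟨_, _, h⟩ | ⟨_, _, h⟩ | ⟨_, _, h⟩) <;> exact h

end DualBHK

end Summit.CriticalPhenomena.PercolationContinuityZ3.Theorems
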